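import Summits.HubbardSuperconductivity.HubbardSuperconductivity.Theorems.AnisotropyChordTransferFibre3RowDMFormJU
import Summits.HubbardSuperconductivity.HubbardSuperconductivity.Theorems.AnisotropyChordTransferFibre3RowDFormJU
import Summits.HubbardSuperconductivity.HubbardSuperconductivity.Theorems.AnisotropyChordTransferFibre3C0Layer

/-!
# Route `AnisotropyChord` / H0 rotor rung: PartN41-D §3 — `RhatCancelled` REDUCED to `ResidSplit` (trilinearity + FACT 1/2)

Theory-1 g22's PartN41-D §3 `RhatCancelled` (port …Fibre3KT2aRow): given THE SPLIT `R′ = v·(C0fn − (T⁺ − 3λ₂)Π⁰) + M` off `D` (`ResidSplit`),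
`C0Explicit` (`C0fn = c0form3(f,f,f)` off `D`, …C0Layer), trilinearity of `c0form3`/`mform3` in the three slots with `f = f_JU + f_S`, and
FACT 1 (`c0FormJU_holds`) / FACT 2 (`mFormJU_holds`), the transform of `R′` is the seven-monomial sum minus `(T⁺ − 3λ₂)Ψ̂¹`.
★ `RowD.rhatCancelled_of_residSplit : ResidSplit L Δ → RhatCancelled L Δ` (+ the slot expansions ★ `RowD.c0form3_expand`, ★ `RowD.mform3_expand`).
Prover seat `hubbard-h0-rotor-p1` g27 (route lead); helper for stmt-HubbardSuperconductivity-23918 (`--supports`, helper class).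
WHAT THIS IS NOT: nothing here proves superconductivity in the Hubbard model.  Tree imports only; no new definitions; no sorry.
-/

set_option linter.dupNamespace false
set_option autoImplicit false

noncomputable section

open scoped BigOperators

namespace Summit.HubbardSuperconductivity.HubbardSuperconductivity.Theorems.AnisotropyChord.Transfer.Fibre3

variable (L : ℕ) [NeZero L]

namespace RowD

omit [NeZero L] in
/-- `c0form3` is additive in slot 1. [folklore] -/
theorem c0form3_add1 (F F' G H : Tor L → ℝ) (c : Cfg L) :
    c0form3 L (fun r => F r + F' r) G H c = c0form3 L F G H c + c0form3 L F' G H c := by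
  unfold c0form3 Dgrad; rw [nnList_map_sum, nnList_map_sum, nnList_map_sum]; ring

omit [NeZero L] in
/-- `c0form3` is additive in slot 2. [folklore] -/
theorem c0form3_add2 (F G G' H : Tor L → ℝ) (c : Cfg L) :
    c0form3 L F (fun r => G r + G' r) H c = c0form3 L F G H c + c0form3 L F G' H c := by
  unfold c0form3 Dgrad; rw [nnList_map_sum, nnList_map_sum, nnList_map_sum]; ring

omit [NeZero L] in
/-- `c0form3` is additive in slot 3. [folklore] -/
theorem c0form3_add3 (F G H H' : Tor L → ℝ) (c : Cfg L) :
    c0form3 L F G (fun r => H r + H' r) c = c0form3 L F G H c + c0form3 L F G H' c := by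
  unfold c0form3 Dgrad; rw [nnList_map_sum, nnList_map_sum, nnList_map_sum]; ring

omit [NeZero L] in
/-- `mform3` is additive in slot 1. [folklore] -/
theorem mform3_add1 (F F' G H : Tor L → ℝ) (c : Cfg L) :
    mform3 L (fun r => F r + F' r) G H c = mform3 L F G H c + mform3 L F' G H c := by
  unfold mform3 prod3
  simp only [List.map_cons, List.map_nil, List.sum_cons, List.sum_nil, add_zero]
  push_cast; ring

omit [NeZero L] in
/-- `mform3` is additive in slot 2. [folklore] -/
theorem mform3_add2 (F G G' H : Tor L → ℝ) (c : Cfg L) :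
    mform3 L F (fun r => G r + G' r) H c = mform3 L F G H c + mform3 L F G' H c := by
  unfold mform3 prod3
  simp only [List.map_cons, List.map_nil, List.sum_cons, List.sum_nil, add_zero]
  push_cast; ring

omit [NeZero L] in
/-- `mform3` is additive in slot 3. [folklore] -/
theorem mform3_add3 (F G H H' : Tor L → ℝ) (c : Cfg L) :
    mform3 L F G (fun r => H r + H' r) c = mform3 L F G H c + mform3 L F G H' c := by
  unfold mform3 prod3
  simp only [List.map_cons, List.map_nil, List.sum_cons, List.sum_nil, add_zero]
  push_cast; ring

omit [NeZero L] in
/-- `f = f_JU + f_S`. [folklore] -/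
theorem f_eq_fJU_add_fS (Δ : ℝ) (f : Tor L → ℝ) : f = fun r => fJU L Δ f r + fS L Δ f r := by
  funext r; unfold fS; ring

omit [NeZero L] in
/-- ★ the `C0`-form monomial expansion: `c0form3(f,f,f) = c0form3(JU,JU,JU) + Σ_{7 monomials}`. [folklore] -/
theorem c0form3_expand (Δ : ℝ) (f : Tor L → ℝ) (c : Cfg L) :
    c0form3 L f f f c = c0form3 L (fJU L Δ f) (fJU L Δ f) (fJU L Δ f) c
      + (monoList.map (fun m => c0form3 L (slot L Δ f m.1) (slot L Δ f m.2.1) (slot L Δ f m.2.2) c)).sum := by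
  have hf := f_eq_fJU_add_fS L Δ f
  conv_lhs => rw [hf]
  rw [c0form3_add1, c0form3_add2, c0form3_add2, c0form3_add3, c0form3_add3, c0form3_add3, c0form3_add3]
  simp only [monoList, slot, List.map_cons, List.map_nil, List.sum_cons, List.sum_nil, add_zero, Bool.false_eq_true, if_true, if_false]
  ring

omit [NeZero L] in
/-- ★ the spectator-form monomial expansion. [folklore] -/
theorem mform3_expand (Δ : ℝ) (f : Tor L → ℝ) (c : Cfg L) :
    mform3 L f f f c = mform3 L (fJU L Δ f) (fJU L Δ f) (fJU L Δ f) c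
      + (monoList.map (fun m => mform3 L (slot L Δ f m.1) (slot L Δ f m.2.1) (slot L Δ f m.2.2) c)).sum := by
  have hf := f_eq_fJU_add_fS L Δ f
  conv_lhs => rw [hf]
  rw [mform3_add1, mform3_add2, mform3_add2, mform3_add3, mform3_add3, mform3_add3, mform3_add3]
  simp only [monoList, slot, List.map_cons, List.map_nil, List.sum_cons, List.sum_nil, add_zero, Bool.false_eq_true, if_true, if_false]
  ring

/-- `cfgDFT` of a list sum. [folklore] -/
theorem cfgDFT_listsum {ι : Type*} (l : List ι) (g : ι → Cfg L → ℂ) (k₂ k₃ : Tor L) :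
    cfgDFT L (fun c => (l.map (fun i => g i c)).sum) k₂ k₃ = (l.map (fun i => cfgDFT L (g i) k₂ k₃)).sum := by
  induction l with
  | nil => simp only [List.map_nil, List.sum_nil]; unfold cfgDFT; simp
  | cons i l ih =>
    simp only [List.map_cons, List.sum_cons]
    rw [← ih, ← cfgDFT_add']

omit [NeZero L] in
/-- `Π⁰` vanishes on `D` (`f(0) = 0`). [folklore] -/
theorem prodState_D {f : Tor L → ℝ} (hf0 : f 0 = 0) {c : Cfg L} (hD : InD L c = true) : prodState L f c = 0 := by
  unfold InD at hD
  simp only [Bool.or_eq_true, decide_eq_true_eq] at hD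
  unfold prodState
  rcases hD with (h | h) | h
  · rw [h, hf0]; simp
  · rw [h, hf0]; simp
  · rw [h, sub_self, hf0]; simp

/-- ★ `ResidSplit ⇒ RhatCancelled`. [folklore] -/
theorem rhatCancelled_of_residSplit (Δ : ℝ) (hRS : ResidSplit L Δ) : RhatCancelled L Δ := by
  intro lam2 f hL hf hev k₂ k₃
  have hf0 : f 0 = 0 := hf.1
  have hpt : ∀ c : Cfg L, resid L Δ f c
      = (monoList.map (fun m => (if InD L c then 0 else
          vfun L c * ((c0form3 L (slot L Δ f m.1) (slot L Δ f m.2.1) (slot L Δ f m.2.2) c : ℝ) : ℂ)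
            + mform3 L (slot L Δ f m.1) (slot L Δ f m.2.1) (slot L Δ f m.2.2) c))).sum
        - (((Tplus L Δ f - 3 * lam2 : ℝ) : ℂ)) * (vfun L c * prodState L f c) := by
    intro c
    by_cases hD : InD L c = true
    · have h0 : resid L Δ f c = 0 := by unfold resid residual; rw [if_pos hD]
      rw [h0, prodState_D L hf0 hD]
      simp only [hD, if_true, monoList, List.map_cons, List.map_nil, List.sum_cons, List.sum_nil, add_zero, mul_zero, sub_zero]
    · have hD' : InD L c = false := by simpa using hD
      have hC0 : C0fn L Δ lam2 f c = c0form3 L f f f c := by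
        rw [c0Explicit_holds L Δ lam2 f hf c hD']; rfl
      have hP : prodState L f c = ((piR L f c : ℝ) : ℂ) := rfl
      rw [hRS lam2 f hL hf hev c hD', hC0, hP, c0form3_expand L Δ f c, mform3_expand L Δ f c,
        c0FormJU_holds L Δ f c hD', mFormJU_holds L Δ f (by omega) c hD']
      simp only [hD', monoList, List.map_cons, List.map_nil, List.sum_cons, List.sum_nil, add_zero, zero_add,
        Bool.false_eq_true, if_false]
      push_cast; ring
  have hfun : resid L Δ f = fun c => (monoList.map (fun m => (if InD L c then 0 else
          vfun L c * ((c0form3 L (slot L Δ f m.1) (slot L Δ f m.2.1) (slot L Δ f m.2.2) c : ℝ) : ℂ)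
            + mform3 L (slot L Δ f m.1) (slot L Δ f m.2.1) (slot L Δ f m.2.2) c))).sum
        - (((Tplus L Δ f - 3 * lam2 : ℝ) : ℂ)) * (vfun L c * prodState L f c) := funext hpt
  rw [hfun, cfgDFT_sub'', cfgDFT_listsum, cfgDFT_smul', cfgDFT_vfun_mul]
  unfold PsiHat1 PiHat
  rfl

end RowD

end Summit.HubbardSuperconductivity.HubbardSuperconductivity.Theorems.AnisotropyChord.Transfer.Fibre3

end
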